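import Summits.CriticalPhenomena.PercolationContinuityZ3.Theorems.PercNearOneGluingNoHeavyLowerTailKNGoodLoser
import Summits.CriticalPhenomena.PercolationContinuityZ3.Theorems.PercNearOneGluingNoHeavyLowerTailKNGoodSeriesTools
import Summits.CriticalPhenomena.PercolationContinuityZ3.Theorems.PercNearOneGluingNoHeavyLowerTailKNGoodNotLonely
import HarnessLib

/-!
# The port-free witness reduction for the gluing inequality GC, and GC for gain-free (e.g. bare) witnesses
# (`NoHeavyLowerTail` cell, stmt-CriticalPhenomena-4575; prover `prim-hp-2`, deletion–contraction line, gen 4)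

Support file (`--supports stmt-CriticalPhenomena-4575`).  No definitions, no named facts, no sorries.
`μ_u = prodBernoulli u`; `agood(u, v; a) := P_u(v ↔ b) − P_u(a ↔ b) + Σ_{W ∩ A = ∅} P_u(C(v) = W)·min_{a′} P_u(a′ ↔ b off W)` is written out
in full (as in `KNGoodSeriesTools`).  The gluing inequality GC of the series step (`KNGoodSeries.knGood_series_of_gluing`, hypothesis `hGC`)
is `agood(u*, x; a₀) ≥ 0` for `u* = (G − o)[s(x,y) ↦ 1]` and `a₀ = argmin_{G−o} P(· ↔ b)`.

* `KNGoodPortFree.real_clusterIs_update_one_eq_zero` — with the pair `s(x,a)` glued, `P(C(x) = W) = 0` for every `W ∌ a`.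
* `KNGoodPortFree.agood_update_one_eq_zero` — `agood(u[s(x,a) ↦ 1], x; a) = 0` for a relay `a ∈ A` (corner value).
* `KNGoodPortFree.agood_eq_factor_pair` — `agood(u, x; a) = (1 − u s(x,a)) · agood(u[s(x,a) ↦ 0], x; a)` (`agood_affine_pair` + corner).
* `KNGoodPortFree.agood_swap_glued` — if `u s(x,y) = 1` then `agood(u, x; a) = agood(u, y; a)` (the glued twins are exchangeable).
* `KNGoodPortFree.agood_eq_factor_two_hairs` — for `u s(x,y) = 1`:
  `agood(u, x; a) = (1 − u s(x,a))(1 − u s(y,a)) · agood(u[s(x,a) ↦ 0][s(y,a) ↦ 0], x; a)`.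
* `KNGoodPortFree.agood_nonneg_of_noGain` — **GC / Conjecture M for a gain-free witness**: if `(u₂, A, x, b)` is good, `a₀` minimises
  `P_u(· ↔ b)` over `A`, `P_u(a′ ↔ b) ≤ P_{u₂}(a′ ↔ b)` for all `a′ ∈ A` and `P_{u₂}(a₀ ↔ b) ≤ P_u(a₀ ↔ b)`, then `agood(u₂, x; a₀) ≥ 0`.
* `KNGoodPortFree.gc_of_hairless_noGain` — **the port-free reduction, assembled**: with `u* s(x,y) = 1`, `a₀ ∈ argmin_u`, `u ≤ u*`,
  `u s(x,a₀) = u* s(x,a₀) < 1`, `u s(y,a₀) = u* s(y,a₀) < 1`, writing `u′ = u[xa₀ ↦ 0][ya₀ ↦ 0]`, `u*′ = u*[xa₀ ↦ 0][ya₀ ↦ 0]`: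
  if `(u*′, A, x, b)` is good and `P_{u*′}(a₀ ↔ b) ≤ P_{u′}(a₀ ↔ b)` (the hairless witness gains nothing from `u′` to `u*′` — e.g. its only
  pair is to `b`), then `agood(u*, x; a₀) ≥ 0`.  Ingredients: `agood_eq_factor_two_hairs`, loser-lowering `KNGoodLoser.argmin_of_lower_pairs`,
  `agood_nonneg_of_noGain`.  This proves GC (hence the series step for goodness and `KNGood` at `o`) for two multi-port pendant stars on
  every relay core in which `b` separates the `G−o`-loneliest relay (hairs removed) from the ports — e.g. a hub-star core (`G − b` a forest).
-/

noncomputable section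

namespace Summit.CriticalPhenomena.PercolationContinuityZ3.Theorems

open MeasureTheory Set Literature.Probability.LatticeModels Literature.Probability.Percolation
open scoped Classical BigOperators

variable {n : ℕ}

namespace KNGoodPortFree

open ChampionStability KNGoodHair KNGoodAux KNGoodLoser KNGoodSeries KNGoodNotLonely

/-- With the pair `s(x,a)` glued, the cluster of `x` contains `a` almost surely: `P_{u[s(x,a)↦1]}(C(x) = W) = 0` if `a ∉ W`.
[folklore] -/
theorem real_clusterIs_update_one_eq_zero (u : Sym2 (Fin n) → unitInterval) (x a : Fin n) (hxa : x ≠ a)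
    (W : Finset (Fin n)) (haW : a ∉ W) :
    (prodBernoulli (Function.update u s(x, a) 1)).real (clusterIs x W) = 0 := by
  rw [tieLiftTwo_real_update_one u s(x, a)]
  have : (fun ω : BondConfig (Fin n) => insert s(x, a) ω) ⁻¹' (clusterIs x W : Set (BondConfig (Fin n))) = ∅ := by
    ext ω
    simp only [mem_preimage, mem_empty_iff_false, iff_false]
    intro hω
    rw [mem_clusterIs] at hω
    have ha : a ∈ openCluster (insert s(x, a) ω) x := by
      show (openGraph (insert s(x, a) ω)).Reachable x a
      rw [reachable_insert_left_iff ω hxa a]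
      exact Or.inr (SimpleGraph.Reachable.refl a)
    rw [hω, Finset.mem_coe] at ha
    exact haW ha
  rw [this, measureReal_empty]

/-- **Corner value.**  For a relay `a ∈ A` and `x ≠ a`: `agood(u[s(x,a) ↦ 1], x; a) = 0` (glued to `a`, the observer is exactly as
connected as `a` and its cluster is never relay-free). [folklore] -/
theorem agood_update_one_eq_zero (u : Sym2 (Fin n) → unitInterval) (A : Finset (Fin n)) (hA : A.Nonempty)
    (x a b : Fin n) (hxa : x ≠ a) (ha : a ∈ A) :
    (prodBernoulli (Function.update u s(x, a) 1)).real (openConn x b) -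
        (prodBernoulli (Function.update u s(x, a) 1)).real (openConn a b) +
        ∑ W ∈ nullSets A, (prodBernoulli (Function.update u s(x, a) 1)).real (clusterIs x W) *
          A.inf' hA (fun a' => (prodBernoulli (Function.update u s(x, a) 1)).real (openConnIn ((↑W : Set (Fin n))ᶜ) a' b)) = 0 := by
  have h1 : (prodBernoulli (Function.update u s(x, a) 1)).real (openConn a b) =
      (prodBernoulli (Function.update u s(x, a) 1)).real (openConn x b) := real_openConn_update_one_glued u x a b hxa
  have h2 : ∑ W ∈ nullSets A, (prodBernoulli (Function.update u s(x, a) 1)).real (clusterIs x W) *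
      A.inf' hA (fun a' => (prodBernoulli (Function.update u s(x, a) 1)).real (openConnIn ((↑W : Set (Fin n))ᶜ) a' b)) = 0 := by
    refine Finset.sum_eq_zero fun W hW => ?_
    have haW : a ∉ W := by
      rw [mem_nullSets] at hW
      exact fun h => Finset.disjoint_left.1 hW h ha
    rw [real_clusterIs_update_one_eq_zero u x a hxa W haW, zero_mul]
  rw [h1, h2]; ring

/-- **Factoring out a pair at the observer towards the witness.**  For `a ∈ A`, `x ≠ a`:
`agood(u, x; a) = (1 − u s(x,a)) · agood(u[s(x,a) ↦ 0], x; a)`. [folklore] -/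
theorem agood_eq_factor_pair (u : Sym2 (Fin n) → unitInterval) (A : Finset (Fin n)) (hA : A.Nonempty)
    (x a b : Fin n) (hxa : x ≠ a) (ha : a ∈ A) :
    (prodBernoulli u).real (openConn x b) - (prodBernoulli u).real (openConn a b) +
        ∑ W ∈ nullSets A, (prodBernoulli u).real (clusterIs x W) *
          A.inf' hA (fun a' => (prodBernoulli u).real (openConnIn ((↑W : Set (Fin n))ᶜ) a' b)) =
      (1 - (u s(x, a) : ℝ)) *
        ((prodBernoulli (Function.update u s(x, a) 0)).real (openConn x b) -
          (prodBernoulli (Function.update u s(x, a) 0)).real (openConn a b) +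
          ∑ W ∈ nullSets A, (prodBernoulli (Function.update u s(x, a) 0)).real (clusterIs x W) *
            A.inf' hA (fun a' => (prodBernoulli (Function.update u s(x, a) 0)).real (openConnIn ((↑W : Set (Fin n))ᶜ) a' b))) := by
  have h := agood_affine_pair u A hA x a a b (u s(x, a))
  rw [Function.update_eq_self] at h
  rw [h, agood_update_one_eq_zero u A hA x a b hxa ha, mul_zero, add_zero]

/-- **Glued twins are exchangeable as observers.**  If `u s(x,y) = 1` then `agood(u, x; a) = agood(u, y; a)`. [folklore] -/
theorem agood_swap_glued (u : Sym2 (Fin n) → unitInterval) (A : Finset (Fin n)) (hA : A.Nonempty)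
    (x y a b : Fin n) (hxy : x ≠ y) (hglue : u s(x, y) = 1) :
    (prodBernoulli u).real (openConn x b) - (prodBernoulli u).real (openConn a b) +
        ∑ W ∈ nullSets A, (prodBernoulli u).real (clusterIs x W) *
          A.inf' hA (fun a' => (prodBernoulli u).real (openConnIn ((↑W : Set (Fin n))ᶜ) a' b)) =
      (prodBernoulli u).real (openConn y b) - (prodBernoulli u).real (openConn a b) +
        ∑ W ∈ nullSets A, (prodBernoulli u).real (clusterIs y W) *
          A.inf' hA (fun a' => (prodBernoulli u).real (openConnIn ((↑W : Set (Fin n))ᶜ) a' b)) := by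
  have hu : u = Function.update u s(x, y) 1 := by rw [← hglue, Function.update_eq_self]
  have h1 : (prodBernoulli u).real (openConn x b) = (prodBernoulli u).real (openConn y b) := by
    rw [hu]; exact (real_openConn_update_one_glued u x y b hxy).symm
  have h2 : ∀ W : Finset (Fin n), (prodBernoulli u).real (clusterIs x W) = (prodBernoulli u).real (clusterIs y W) := by
    intro W
    rw [hu, tieLiftTwo_real_update_one u s(x, y), tieLiftTwo_real_update_one u s(x, y)]
    congr 1
    ext ω
    simp only [mem_preimage]
    rw [mem_clusterIs, mem_clusterIs]
    have hC : openCluster (insert s(x, y) ω) x = openCluster (insert s(x, y) ω) y := by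
      ext z
      show (openGraph (insert s(x, y) ω)).Reachable x z ↔ (openGraph (insert s(x, y) ω)).Reachable y z
      have hx : (openGraph (insert s(x, y) ω)).Reachable x z ↔
          ((openGraph ω).Reachable x z ∨ (openGraph ω).Reachable y z) := reachable_insert_left_iff ω hxy z
      have hy : (openGraph (insert s(y, x) ω)).Reachable y z ↔
          ((openGraph ω).Reachable y z ∨ (openGraph ω).Reachable x z) := reachable_insert_left_iff ω (Ne.symm hxy) z
      rw [Sym2.eq_swap] at hy
      rw [hx, hy, or_comm]
    rw [hC]
  rw [h1]
  congr 1
  exact Finset.sum_congr rfl fun W _ => by rw [h2 W]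

/-- **Factoring out both hairs of the witness at a glued pair of observers.**  If `u s(x,y) = 1`, `a ∈ A`, `x ≠ a`, `y ≠ a`, `x ≠ y`:
`agood(u, x; a) = (1 − u s(x,a))(1 − u s(y,a)) · agood(u[s(x,a) ↦ 0][s(y,a) ↦ 0], x; a)`. [folklore] -/
theorem agood_eq_factor_two_hairs (u : Sym2 (Fin n) → unitInterval) (A : Finset (Fin n)) (hA : A.Nonempty)
    (x y a b : Fin n) (hxa : x ≠ a) (hya : y ≠ a) (hxy : x ≠ y) (ha : a ∈ A) (hglue : u s(x, y) = 1) :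
    (prodBernoulli u).real (openConn x b) - (prodBernoulli u).real (openConn a b) +
        ∑ W ∈ nullSets A, (prodBernoulli u).real (clusterIs x W) *
          A.inf' hA (fun a' => (prodBernoulli u).real (openConnIn ((↑W : Set (Fin n))ᶜ) a' b)) =
      (1 - (u s(x, a) : ℝ)) * (1 - (u s(y, a) : ℝ)) *
        ((prodBernoulli (Function.update (Function.update u s(x, a) 0) s(y, a) 0)).real (openConn x b) -
          (prodBernoulli (Function.update (Function.update u s(x, a) 0) s(y, a) 0)).real (openConn a b) +
          ∑ W ∈ nullSets A, (prodBernoulli (Function.update (Function.update u s(x, a) 0) s(y, a) 0)).real (clusterIs x W) *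
            A.inf' hA (fun a' => (prodBernoulli (Function.update (Function.update u s(x, a) 0) s(y, a) 0)).real
              (openConnIn ((↑W : Set (Fin n))ᶜ) a' b))) := by
  set u₁ := Function.update u s(x, a) 0 with hu₁
  set u₂ := Function.update u₁ s(y, a) 0 with hu₂
  have hne1 : s(x, y) ≠ s(x, a) := by
    intro h; exact hya ((Sym2.congr_right).1 h)
  have hne2 : s(x, y) ≠ s(y, a) := by
    intro h
    rw [Sym2.eq_swap] at h
    exact hxa ((Sym2.congr_right).1 h)
  have hglue₁ : u₁ s(x, y) = 1 := by rw [hu₁, Function.update_of_ne hne1, hglue]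
  have hglue₂ : u₂ s(x, y) = 1 := by rw [hu₂, Function.update_of_ne hne2, hglue₁]
  have hya' : u₁ s(y, a) = u s(y, a) := by
    rw [hu₁, Function.update_of_ne]
    intro h
    exact hxy ((Sym2.congr_left).1 h).symm
  rw [agood_eq_factor_pair u A hA x a b hxa ha, ← hu₁, agood_swap_glued u₁ A hA x y a b hxy hglue₁,
    agood_eq_factor_pair u₁ A hA y a b hya ha, ← hu₂, hya', ← agood_swap_glued u₂ A hA x y a b hxy hglue₂]
  ring

/-- **GC / Conjecture M for a gain-free witness.**  If `(u₂, A, x, b)` is good, `a₀ ∈ A` minimises `P_u(· ↔ b)` over `A`, every relay is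
at least as connected in `u₂` as in `u`, and the witness gains nothing (`P_{u₂}(a₀ ↔ b) ≤ P_u(a₀ ↔ b)`), then `agood(u₂, x; a₀) ≥ 0`.
[cite: KozmaNitzan2024, Definition p. 12 — extension] -/
theorem agood_nonneg_of_noGain (u u₂ : Sym2 (Fin n) → unitInterval) (A : Finset (Fin n)) (hA : A.Nonempty)
    (x a₀ b : Fin n) (hgood : KNGood u₂ A hA x b)
    (hmin : ∀ a' ∈ A, (prodBernoulli u).real (openConn a₀ b) ≤ (prodBernoulli u).real (openConn a' b))
    (hmono : ∀ a' ∈ A, (prodBernoulli u).real (openConn a' b) ≤ (prodBernoulli u₂).real (openConn a' b))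
    (hnogain : (prodBernoulli u₂).real (openConn a₀ b) ≤ (prodBernoulli u).real (openConn a₀ b)) :
    0 ≤ (prodBernoulli u₂).real (openConn x b) - (prodBernoulli u₂).real (openConn a₀ b) +
        ∑ W ∈ nullSets A, (prodBernoulli u₂).real (clusterIs x W) *
          A.inf' hA (fun a' => (prodBernoulli u₂).real (openConnIn ((↑W : Set (Fin n))ᶜ) a' b)) := by
  have hle : (prodBernoulli u₂).real (openConn a₀ b) ≤ A.inf' hA (fun a' => (prodBernoulli u₂).real (openConn a' b)) := by
    rw [Finset.le_inf'_iff]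
    intro a' ha'
    exact hnogain.trans ((hmin a' ha').trans (hmono a' ha'))
  have hg := hgood
  rw [KNGood] at hg
  linarith

/-- **The port-free reduction, assembled (GC for a hairless gain-free witness).**  Let `u ≤ u*` pointwise with `u* s(x,y) = 1`,
`x, y, a₀` distinct... precisely `x ≠ a₀`, `y ≠ a₀`, `x ≠ y`, `a₀ ∈ A` minimising `P_u(· ↔ b)` over `A`, the two hairs `s(x,a₀)`,
`s(y,a₀)` having the same weight in `u` and `u*`, both `< 1`.  Put `u′ = u[xa₀ ↦ 0][ya₀ ↦ 0]`, `u*′ = u*[xa₀ ↦ 0][ya₀ ↦ 0]`.  If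
`(u*′, A, x, b)` is good and `P_{u*′}(a₀ ↔ b) ≤ P_{u′}(a₀ ↔ b)`, then `agood(u*, x; a₀) ≥ 0` — the gluing inequality `hGC` of
`KNGoodSeries.knGood_series_of_gluing`. [cite: KozmaNitzan2024, Thm. 5 (pp. 13–14) — extension] -/
theorem gc_of_hairless_noGain (u ustar : Sym2 (Fin n) → unitInterval) (A : Finset (Fin n)) (hA : A.Nonempty)
    (x y a₀ b : Fin n) (hxa : x ≠ a₀) (hya : y ≠ a₀) (hxy : x ≠ y) (ha₀ : a₀ ∈ A) (hglue : ustar s(x, y) = 1)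
    (hle : ∀ e, u e ≤ ustar e) (hhx : u s(x, a₀) = ustar s(x, a₀)) (hhy : u s(y, a₀) = ustar s(y, a₀))
    (hx1 : (u s(x, a₀) : ℝ) < 1) (hy1 : (u s(y, a₀) : ℝ) < 1)
    (hmin : ∀ a' ∈ A, (prodBernoulli u).real (openConn a₀ b) ≤ (prodBernoulli u).real (openConn a' b))
    (hgood : KNGood (Function.update (Function.update ustar s(x, a₀) 0) s(y, a₀) 0) A hA x b)
    (hnogain : (prodBernoulli (Function.update (Function.update ustar s(x, a₀) 0) s(y, a₀) 0)).real (openConn a₀ b) ≤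
      (prodBernoulli (Function.update (Function.update u s(x, a₀) 0) s(y, a₀) 0)).real (openConn a₀ b)) :
    0 ≤ (prodBernoulli ustar).real (openConn x b) - (prodBernoulli ustar).real (openConn a₀ b) +
        ∑ W ∈ nullSets A, (prodBernoulli ustar).real (clusterIs x W) *
          A.inf' hA (fun a' => (prodBernoulli ustar).real (openConnIn ((↑W : Set (Fin n))ᶜ) a' b)) := by
  set u' := Function.update (Function.update u s(x, a₀) 0) s(y, a₀) 0 with hu'
  set us' := Function.update (Function.update ustar s(x, a₀) 0) s(y, a₀) 0 with hus'
  rw [agood_eq_factor_two_hairs ustar A hA x y a₀ b hxa hya hxy ha₀ hglue, ← hus']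
  have hxy' : s(x, a₀) ≠ s(y, a₀) := by
    intro h; exact hxy ((Sym2.congr_left).1 h)
  -- `a₀` is still the `u'`-minimiser (loser-lowering at `a₀` on the pairs to `x` and `y`)
  have hxZ : a₀ ∉ ({x, y} : Finset (Fin n)) := by
    simp only [Finset.mem_insert, Finset.mem_singleton, not_or]
    exact ⟨fun h => hxa h.symm, fun h => hya h.symm⟩
  have hmin' : ∀ a' ∈ A, (prodBernoulli u').real (openConn a₀ b) ≤ (prodBernoulli u').real (openConn a' b) := by
    refine argmin_of_lower_pairs u u' A a₀ b {x, y} hxZ ?_ ?_ ?_ hmin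
    · intro e he
      have hex : e ≠ s(y, a₀) := by rw [Sym2.eq_swap]; exact he y (by simp)
      have hey : e ≠ s(x, a₀) := by rw [Sym2.eq_swap]; exact he x (by simp)
      rw [hu', Function.update_of_ne hex, Function.update_of_ne hey]
    · intro z hz
      simp only [Finset.mem_insert, Finset.mem_singleton] at hz
      rcases hz with rfl | rfl
      · rw [Sym2.eq_swap, hu', Function.update_of_ne hxy', Function.update_self]; exact bot_le
      · rw [Sym2.eq_swap, hu', Function.update_self]; exact bot_le
    · intro z hz
      simp only [Finset.mem_insert, Finset.mem_singleton] at hz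
      rcases hz with rfl | rfl
      · rw [Sym2.eq_swap]; exact hx1
      · rw [Sym2.eq_swap]; exact hy1
  -- monotonicity `u' ≤ us'`
  have hle' : ∀ e, u' e ≤ us' e := by
    intro e
    by_cases h1 : e = s(y, a₀)
    · rw [h1, hu', hus', Function.update_self, Function.update_self]
    · by_cases h2 : e = s(x, a₀)
      · rw [h2, hu', hus', Function.update_of_ne hxy', Function.update_of_ne hxy', Function.update_self, Function.update_self]
      · rw [hu', hus', Function.update_of_ne h1, Function.update_of_ne h1, Function.update_of_ne h2, Function.update_of_ne h2]
        exact hle e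
  have hmono : ∀ a' ∈ A, (prodBernoulli u').real (openConn a' b) ≤ (prodBernoulli us').real (openConn a' b) :=
    fun a' _ => real_openConn_mono a' b _ us' u' rfl hle'
  have hnn := agood_nonneg_of_noGain u' us' A hA x a₀ b hgood hmin' hmono hnogain
  have h1 : 0 ≤ 1 - (ustar s(x, a₀) : ℝ) := by linarith [(ustar s(x, a₀)).2.2]
  have h2 : 0 ≤ 1 - (ustar s(y, a₀) : ℝ) := by linarith [(ustar s(y, a₀)).2.2]
  exact mul_nonneg (mul_nonneg h1 h2) hnn

end KNGoodPortFree

end Summit.CriticalPhenomena.PercolationContinuityZ3.Theorems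

end
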